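import Literature.AnabelianGeometry.EtaleTheta.ConstantMultipleRigidity
import HarnessLib

/-!
# [EtTh] §1, Def. 1.9 / Rmk. 1.9.1: "standard type" is an orbit invariant, and the author's erratum
# (Comments, March 2022, item (vi)) to Def. 1.9 (ii)

Mochizuki, *The étale theta function …*, Publ. RIMS **45** (2009), §1, Def. 1.9 and Rmk. 1.9.1, PRIMS
PDF p. 29 (printed 255) [cite: MochizukiEtTh2009, Def 1.9 p.29]; the author's *Comments on "The étale
theta function …"* (kurims, March 2022), item (vi): «The phrase "the unique value `∈ O^×_K`" in the
first line of Definition 1.9, (ii), should read "the unique value `∈ K^×`"». Layer L2 of the abc-iut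
cell, seat abc-iut-L2-t1. PROOF-ONLY companion (no `def`) of `ConstantMultipleRigidity.lean`
(`MuTwoSetting.thetaOrbit`, `valuesAt`, `IsStandardSetOfValues`, `IsOfStandardType`).

Contents:
* `MuTwoSetting.isOfStandardType_iff_exists_eq_one_or_neg_one` — the predicate `IsOfStandardType`
  typed from the 2009 text ("the unique value `∈ O^×_K` … of maximal order … is equal to `±1`": a
  minimal-norm value that is a UNIT and equals `±1`) is EQUIVALENT to the author's corrected wording
  ("the unique value `∈ K^×` of maximal order … is `±1`": a minimal-norm value equal to `±1`), since
  `±1 ∈ O^×_K` automatically — so the landed predicate needs no repair (kernel-checked ERRATUM record);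
* Rmk. 1.9.1, consequences of its first clause ("any inner automorphism of `Π^tp_Ċ` arising from
  `Π^tp_Ẋ` acts trivially on `η̈^{Θ,Z}`", p. 29; PROVED upstream as
  `rmk191_conj_image_thetaOrbit`): the orbit `η̈^{Θ,Z}`, its sets of values at a point, its standard
  sets of values and the property "of standard type" are UNCHANGED when the class `η̈^Θ` is replaced
  by any `Π^tp_Ẋ`-conjugate — `thetaOrbit_conj_eq`, `valuesAt_conj_eq`,
  `isStandardSetOfValues_conj_iff`, `isOfStandardType_conj_iff`; and membership is symmetric /
  orbits of members coincide (`mem_thetaOrbit_self`, `thetaOrbit_eq_of_mem`).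
HONEST FRAMING: typed ≠ proved for [EtTh]; nothing here asserts Thm. 1.10; no side is taken on any
disputed claim.
-/

noncomputable section

namespace Literature.AnabelianGeometry.EtaleTheta

open Literature.AnabelianGeometry.SemiGraphs

namespace MuTwoSetting

variable {p : ℕ} [Fact p.Prime] {M : MuTwoSetting p}

/-! ### Def. 1.9 (ii): the 2009 wording and the 2022 correction agree -/

/-- `±1 ∈ O^×_K̈`: a unit of `K̈` whose image in `ℚ̄_p` is `1` or `−1` has absolute value `1`.
[cite: MochizukiEtTh2009, Def 1.9 (ii) p.29] -/
theorem mem_unitsOKdd_of_eq_one_or_neg_one (D : ThetaSetting p) {v : (↥D.Kdd)ˣ}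
    (hv : ((v : D.Kdd) : PadicAlgCl p) = 1 ∨ ((v : D.Kdd) : PadicAlgCl p) = -1) :
    v ∈ D.unitsOKdd := by
  change ‖((v : D.Kdd) : PadicAlgCl p)‖ = 1
  rcases hv with h | h
  · rw [h, norm_one]
  · rw [h, norm_neg, norm_one]

/-- **Def. 1.9 (ii) under the author's ERRATUM** (Comments on [EtTh], March 2022, item (vi): "the
unique value `∈ O^×_K`" should read "the unique value `∈ K^×`"): the landed predicate
`IsOfStandardType` (2009 wording: a value of maximal order of some standard set of values is a unit
equal to `±1`) is equivalent to the corrected wording (a value of maximal order of some standard set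
of values equals `±1`) — the unit clause is implied by `= ±1`.
[cite: MochizukiEtTh2009, Def 1.9 (ii) p.29] -/
theorem isOfStandardType_iff_exists_eq_one_or_neg_one {E : M.toThetaSetting.KummerData}
    (hC : M.toThetaSetting.Compat) (εZ : M.GtpC) (S : M.StandardData E)
    (x : M.toThetaSetting.H1 M.toThetaSetting.GtpYdd) :
    M.IsOfStandardType hC εZ S x ↔
      ∃ V, IsStandardSetOfValues hC εZ S x V ∧ ∃ v ∈ V,
        (∀ w ∈ V, ‖((v : M.Kdd) : PadicAlgCl p)‖ ≤ ‖((w : M.Kdd) : PadicAlgCl p)‖) ∧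
        (((v : M.Kdd) : PadicAlgCl p) = 1 ∨ ((v : M.Kdd) : PadicAlgCl p) = -1) := by
  constructor
  · rintro ⟨V, hV, v, hv, hmin, -, hpm⟩
    exact ⟨V, hV, v, hv, hmin, hpm⟩
  · rintro ⟨V, hV, v, hv, hmin, hpm⟩
    exact ⟨V, hV, v, hv, hmin, mem_unitsOKdd_of_eq_one_or_neg_one M.toThetaSetting hpm, hpm⟩

/-! ### Rmk. 1.9.1: the orbit `η̈^{Θ,Z}` and "standard type" are `Π^tp_Ẋ`-conjugation invariants -/

/-- A class lies in its own `Π^tp_Ẋ/Π^tp_Ÿ`-orbit (Def. 1.9, p. 29).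
[cite: MochizukiEtTh2009, Def 1.9 p.29] -/
theorem mem_thetaOrbit_self (hC : M.toThetaSetting.Compat) (εZ : M.GtpC)
    (x : M.toThetaSetting.H1 M.toThetaSetting.GtpYdd) :
    x ∈ M.thetaOrbit hC εZ x := by
  haveI := hC.GtpYdd_normal
  refine ⟨1, ?_, ?_⟩
  · rw [map_one]; exact (M.dotX εZ).one_mem
  · exact (ContH1.conj_one_apply (φ := M.toTheta) (A := M.toThetaSetting.DeltaTheta) x).symm

/-- **Rmk. 1.9.1, first clause, orbit form** (p. 29): replacing `η̈^Θ` by a conjugate under an element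
of `Π^tp_X` lying in `Π^tp_Ẋ` does not change the orbit `η̈^{Θ,Z}`.
[cite: MochizukiEtTh2009, Rmk 1.9.1 p.29] -/
theorem thetaOrbit_conj_eq (hC : M.toThetaSetting.Compat) (εZ : M.GtpC)
    (x : M.toThetaSetting.H1 M.toThetaSetting.GtpYdd) {σ : M.PiTemp} (hσ : M.inclX σ ∈ M.dotX εZ) :
    (haveI := hC.GtpYdd_normal
     M.thetaOrbit hC εZ (ContH1.conj M.toTheta M.toThetaSetting.DeltaTheta σ x) =
      M.thetaOrbit hC εZ x) := by
  haveI := hC.GtpYdd_normal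
  ext y
  constructor
  · rintro ⟨τ, hτ, rfl⟩
    refine ⟨τ * σ, ?_, ?_⟩
    · rw [map_mul]; exact (M.dotX εZ).mul_mem hτ hσ
    · exact (ContH1.conj_mul_apply (φ := M.toTheta) (A := M.toThetaSetting.DeltaTheta) τ σ x).symm
  · rintro ⟨τ, hτ, rfl⟩
    refine ⟨τ * σ⁻¹, ?_, ?_⟩
    · rw [map_mul, map_inv]; exact (M.dotX εZ).mul_mem hτ ((M.dotX εZ).inv_mem hσ)
    · rw [ContH1.conj_mul_apply, ContH1.conj_inv_conj_apply]

/-- The orbit of any member of `η̈^{Θ,Z}` is `η̈^{Θ,Z}` itself (p. 29). [cite: MochizukiEtTh2009, Rmk 1.9.1 p.29] -/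
theorem thetaOrbit_eq_of_mem (hC : M.toThetaSetting.Compat) (εZ : M.GtpC)
    {x y : M.toThetaSetting.H1 M.toThetaSetting.GtpYdd} (hy : y ∈ M.thetaOrbit hC εZ x) :
    M.thetaOrbit hC εZ y = M.thetaOrbit hC εZ x := by
  obtain ⟨σ, hσ, rfl⟩ := hy
  exact thetaOrbit_conj_eq hC εZ x hσ

/-- **Rmk. 1.9.1, values form** (p. 29): the set of values of `η̈^{Θ,Z}` at a point `y₀` (Def. 1.9 (i))
does not change when `η̈^Θ` is replaced by a `Π^tp_Ẋ`-conjugate. [cite: MochizukiEtTh2009, Rmk 1.9.1 p.29] -/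
theorem valuesAt_conj_eq {E : M.toThetaSetting.KummerData} (hC : M.toThetaSetting.Compat)
    (εZ : M.GtpC) (x : M.toThetaSetting.H1 M.toThetaSetting.GtpYdd)
    (y₀ : ThetaSetting.NonCuspidalPoint E) {σ : M.PiTemp} (hσ : M.inclX σ ∈ M.dotX εZ) :
    (haveI := hC.GtpYdd_normal
     valuesAt hC εZ (ContH1.conj M.toTheta M.toThetaSetting.DeltaTheta σ x) y₀ =
      valuesAt hC εZ x y₀) := by
  unfold valuesAt
  rw [thetaOrbit_conj_eq hC εZ x hσ]

/-- **Rmk. 1.9.1, standard sets of values** (Def. 1.9 (i), p. 29): unchanged under `Π^tp_Ẋ`-conjugation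
of the class. [cite: MochizukiEtTh2009, Rmk 1.9.1 p.29] -/
theorem isStandardSetOfValues_conj_iff {E : M.toThetaSetting.KummerData}
    (hC : M.toThetaSetting.Compat) (εZ : M.GtpC) (S : M.StandardData E)
    (x : M.toThetaSetting.H1 M.toThetaSetting.GtpYdd) (V : Set (↥M.Kdd)ˣ) {σ : M.PiTemp}
    (hσ : M.inclX σ ∈ M.dotX εZ) :
    (haveI := hC.GtpYdd_normal
     IsStandardSetOfValues hC εZ S (ContH1.conj M.toTheta M.toThetaSetting.DeltaTheta σ x) V ↔
      IsStandardSetOfValues hC εZ S x V) := by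
  unfold IsStandardSetOfValues
  rw [valuesAt_conj_eq hC εZ x S.tau hσ, valuesAt_conj_eq hC εZ x S.tauInv hσ]

/-- **Rmk. 1.9.1, standard type** (Def. 1.9 (ii), p. 29): "of standard type" is a property of the
orbit `η̈^{Θ,Z}` — unchanged under `Π^tp_Ẋ`-conjugation of the class `η̈^Θ`.
[cite: MochizukiEtTh2009, Rmk 1.9.1 p.29] -/
theorem isOfStandardType_conj_iff {E : M.toThetaSetting.KummerData}
    (hC : M.toThetaSetting.Compat) (εZ : M.GtpC) (S : M.StandardData E)
    (x : M.toThetaSetting.H1 M.toThetaSetting.GtpYdd) {σ : M.PiTemp} (hσ : M.inclX σ ∈ M.dotX εZ) :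
    (haveI := hC.GtpYdd_normal
     M.IsOfStandardType hC εZ S (ContH1.conj M.toTheta M.toThetaSetting.DeltaTheta σ x) ↔
      M.IsOfStandardType hC εZ S x) := by
  unfold IsOfStandardType
  simp only [isStandardSetOfValues_conj_iff hC εZ S x _ hσ]

/-- Hence "of standard type" is the same for all members of one orbit `η̈^{Θ,Z}` (p. 29).
[cite: MochizukiEtTh2009, Rmk 1.9.1 p.29] -/
theorem isOfStandardType_eq_of_mem {E : M.toThetaSetting.KummerData}
    (hC : M.toThetaSetting.Compat) (εZ : M.GtpC) (S : M.StandardData E)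
    {x y : M.toThetaSetting.H1 M.toThetaSetting.GtpYdd} (hy : y ∈ M.thetaOrbit hC εZ x) :
    M.IsOfStandardType hC εZ S y ↔ M.IsOfStandardType hC εZ S x := by
  obtain ⟨σ, hσ, rfl⟩ := hy
  exact isOfStandardType_conj_iff hC εZ S x hσ

end MuTwoSetting

end Literature.AnabelianGeometry.EtaleTheta

end
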